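import Literature.IUT.HodgeArakelov.AbsTopMonoidsGenuineGhatLevels
import HarnessLib

/-!
# [IUTchII] Example 1.8 (vii) `(∗ĝp)` GENUINE, part 5: PROFINITE HILBERT 90 for the levels of `O^ĝp(G)` —
# the transition maps `((k̄^×)^J)^∧ → ((k̄^×)^{J'})^∧` are INJECTIVE, the `J`-invariants of `((k̄^×)^N)^∧` come from
# `((k̄^×)^J)^∧`, and the torsion of `O^ĝp(G)` is `η(μ(k̄))`

S. Mochizuki, *Inter-universal Teichmüller theory II*, §1, Example 1.8 (vii) p. 40, Remark 1.11.1 (i) (c) p. 50 (proof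
"involving the Kummer map", [AbsTopIII] Prop. 3.3 (ii)) [claim: Mochizuki2012, status: disputed] (IUTchII §1 Ex 1.8 (vii),
kurims p.40); [cite: NeukirchANT1999, Ch. IV §2 p.274].  abc-iut cell, layer L6, row «GHATGP-GENUINE» STAGE 3b (seat
abc-iut-L6-d2 gen 6; post-freeze def, reading (ii) — the defs are bookkeeping: `levelDegree`, `torsionExp`, `boostExp`,
`invariantRep`).  ELEMENTARY (no cohomology, no finiteness of `μ(L)`): norms `N_{J/N}` + torus Kummer-faithfulness of the
levels (`⋂_n ((k̄^×)^J)ⁿ = 1`, abc-iut-L6-t21) applied to the FINITE sets `μ_d`.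

* **`mem_pow_of_inclusion_mem_pow`** (the boost lemma): with `d = [J:N]` and `M = M(N,d)` the torsion exponent, an
  `f ∈ (k̄^×)^J` that is an `n·d·M`-th power in `(k̄^×)^N` is an `n`-th power in `(k̄^×)^J` (`f^d = N(t)^{ndM}`; the
  `d`-torsion discrepancy `f · N(t)^{−nM}` is an `M`-th power of level `N`, hence `1`);
* **`levelMap_injective`** (all transition maps of `O^ĝp` injective; normal case `levelMap_injective_of_normal` +
  `exists_openNormal_le`) and **`ofLevel_injective`** (`((k̄^×)^J)^∧ ↪ O^ĝp`);
* **`exists_levelMap_eq_of_invariant`** (profinite Hilbert 90): for `N ⊴ Gal(k̄/k)` open, `N ⊆ J`, an element of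
  `((k̄^×)^N)^∧` invariant under `J` (acting through `J/N`) is the image of an element of `((k̄^×)^J)^∧` (descent
  `exists_rep_invariant`: at level `E(n)·d` the norm trick produces a `J`-INVARIANT representative of the `E(n)`-th
  component; compatible by the boost lemma, `rep_compat`);
* **`exists_eq_toOghat_of_pow_eq_one`**: the `n`-torsion of `O^ĝp(G)` is `η(μ_n(k̄))`.

HONEST FRAMING: classical algebra over OUR typed objects; nothing here bears on [IUTchIII] Cor. 3.12; typed ≠ proved elsewhere.
-/

set_option autoImplicit false

noncomputable section

namespace Literature.IUT.HodgeArakelov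

open CategoryTheory
open Literature.AnabelianGeometry.AbsoluteAnabelian

namespace AbsTopMonoids.Genuine

variable (C : MLFClosure.{0})

section NormFacts

variable (J N : OpenSubgroup (C.K ≃ₐ[C.k] C.K)) (hle : (N : Subgroup (C.K ≃ₐ[C.k] C.K)) ≤ J)
  [hN : (N : Subgroup (C.K ≃ₐ[C.k] C.K)).Normal]

omit hN in
/-- The degree `d = [J : N]` of the level extension (a positive natural). [cite: NeukirchANT1999, Ch. IV §2 p.274] -/
def levelDegree : ℕ+ :=
  ⟨Nat.card (↥(J : Subgroup (C.K ≃ₐ[C.k] C.K)) ⧸ ((N : Subgroup (C.K ≃ₐ[C.k] C.K)).subgroupOf J)),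
    haveI := finite_quot C J N; Nat.card_pos⟩

omit hN in
/-- `coe_levelDegree` (structure lemma of the genuine `(∗ĝp)` levels). [claim: Mochizuki2012, status: disputed] (IUTchII §1 Ex 1.8 (vii), kurims p.40) -/
theorem coe_levelDegree : (levelDegree C J N : ℕ) =
    Nat.card (↥(J : Subgroup (C.K ≃ₐ[C.k] C.K)) ⧸ ((N : Subgroup (C.K ≃ₐ[C.k] C.K)).subgroupOf J)) := rfl

omit hN in
/-- The chosen representative lies in `J`. [claim: Mochizuki2012, status: disputed] (IUTchII §1 Ex 1.8 (vii), kurims p.40) -/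
theorem cosetRep_mem (q : ↥(J : Subgroup (C.K ≃ₐ[C.k] C.K)) ⧸ ((N : Subgroup (C.K ≃ₐ[C.k] C.K)).subgroupOf J)) :
    cosetRep C J N q ∈ (J : Subgroup (C.K ≃ₐ[C.k] C.K)) :=
  (Quotient.out q : ↥(J : Subgroup (C.K ≃ₐ[C.k] C.K))).2

/-- `σ ∈ J` fixes the `J`-invariants inside the `N`-invariants. [claim: Mochizuki2012, status: disputed] (IUTchII §1 Ex 1.8 (vii), kurims p.40) -/
theorem galLevel_inclusion (σ : C.K ≃ₐ[C.k] C.K) (hσ : σ ∈ (J : Subgroup (C.K ≃ₐ[C.k] C.K)))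
    (b : fixedUnits C (J : Subgroup (C.K ≃ₐ[C.k] C.K))) :
    galLevel C N σ (Subgroup.inclusion (fixedUnits_mono C hle) b) = Subgroup.inclusion (fixedUnits_mono C hle) b :=
  Subtype.ext (Units.ext (b.2 σ hσ))

/-- `N_{J/N}(a) = a^d` for `a ∈ (k̄^×)^J`. [cite: NeukirchANT1999, Ch. IV §2 p.274] -/
theorem levelNorm_inclusion (a : fixedUnits C (J : Subgroup (C.K ≃ₐ[C.k] C.K))) :
    levelNorm C J N (Subgroup.inclusion (fixedUnits_mono C hle) a) = a ^ (levelDegree C J N : ℕ) := by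
  classical
  haveI := finite_quot C J N
  letI := Fintype.ofFinite (↥(J : Subgroup (C.K ≃ₐ[C.k] C.K)) ⧸ ((N : Subgroup (C.K ≃ₐ[C.k] C.K)).subgroupOf J))
  apply Subtype.ext
  change levelNormFun C J N _ = _
  have hfac : ∀ q : ↥(J : Subgroup (C.K ≃ₐ[C.k] C.K)) ⧸ ((N : Subgroup (C.K ≃ₐ[C.k] C.K)).subgroupOf J),
      normFactor C J N (Subgroup.inclusion (fixedUnits_mono C hle) a) q = (a : (C.K)ˣ) := by
    intro q
    apply Units.ext
    change (cosetRep C J N q) ((a : (C.K)ˣ) : C.K) = _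
    exact a.2 _ (cosetRep_mem C J N q)
  unfold levelNormFun
  rw [Finset.prod_congr rfl (fun q _ => hfac q), Finset.prod_const, Finset.card_univ, Fintype.card_eq_nat_card,
    Subgroup.coe_pow, coe_levelDegree]

/-- If every `σ ∈ J` moves `a` by an `m`-th power of the `N`-invariants, then `N_{J/N}(a) = a^d · c^m`.
[cite: NeukirchANT1999, Ch. IV §2 p.274] -/
theorem levelNorm_eq_pow_mul_pow (a : fixedUnits C (N : Subgroup (C.K ≃ₐ[C.k] C.K))) (m : ℕ)
    (h : ∀ σ : C.K ≃ₐ[C.k] C.K, σ ∈ (J : Subgroup (C.K ≃ₐ[C.k] C.K)) →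
      ∃ c : fixedUnits C (N : Subgroup (C.K ≃ₐ[C.k] C.K)), galLevel C N σ a = a * c ^ m) :
    ∃ c : fixedUnits C (N : Subgroup (C.K ≃ₐ[C.k] C.K)),
      ((levelNorm C J N a : fixedUnits C _) : (C.K)ˣ) = (a : (C.K)ˣ) ^ (levelDegree C J N : ℕ) * (c : (C.K)ˣ) ^ m := by
  classical
  haveI := finite_quot C J N
  letI := Fintype.ofFinite (↥(J : Subgroup (C.K ≃ₐ[C.k] C.K)) ⧸ ((N : Subgroup (C.K ≃ₐ[C.k] C.K)).subgroupOf J))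
  choose c hc using h
  refine ⟨∏ q : ↥(J : Subgroup (C.K ≃ₐ[C.k] C.K)) ⧸ ((N : Subgroup (C.K ≃ₐ[C.k] C.K)).subgroupOf J),
    c (cosetRep C J N q) (cosetRep_mem C J N q), ?_⟩
  change levelNormFun C J N a = _
  have hfac : ∀ q : ↥(J : Subgroup (C.K ≃ₐ[C.k] C.K)) ⧸ ((N : Subgroup (C.K ≃ₐ[C.k] C.K)).subgroupOf J),
      normFactor C J N a q = (a : (C.K)ˣ) * ((c (cosetRep C J N q) (cosetRep_mem C J N q) :
        fixedUnits C _) : (C.K)ˣ) ^ m := by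
    intro q
    change ((galLevel C N (cosetRep C J N q) a : fixedUnits C _) : (C.K)ˣ) = _
    rw [hc]
    rfl
  unfold levelNormFun
  rw [Finset.prod_congr rfl (fun q _ => hfac q), Finset.prod_mul_distrib, Finset.prod_const, Finset.card_univ,
    Fintype.card_eq_nat_card, Finset.prod_pow, Subgroup.val_finsetProd, coe_levelDegree]

/-- The torsion exponent `M(N, d)` of the level `N` (see `exists_torsion_exponent`), chosen once and for all.
[cite: MochizukiAbsTopIII2015, Rmk 1.5.4 (i) p.33] -/
def torsionExp (d : ℕ+) : ℕ+ := (exists_torsion_exponent C N d).choose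

omit hN in
/-- `torsionExp_spec` (structure lemma of the genuine `(∗ĝp)` levels). [claim: Mochizuki2012, status: disputed] (IUTchII §1 Ex 1.8 (vii), kurims p.40) -/
theorem torsionExp_spec (d : ℕ+) (z : fixedUnits C (N : Subgroup (C.K ≃ₐ[C.k] C.K))) (hz : z ^ (d : ℕ) = 1)
    (ht : ∃ t : fixedUnits C (N : Subgroup (C.K ≃ₐ[C.k] C.K)), t ^ ((torsionExp C N d : ℕ+) : ℕ) = z) : z = 1 :=
  (exists_torsion_exponent C N d).choose_spec z hz ht

/-- The exponent `E(n) := n · d · M` (`d = [J:N]`, `M` the torsion exponent of level `N` for `d`).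
[cite: NeukirchANT1999, Ch. IV §2 p.274] -/
def boostExp (n : ℕ+) : ℕ+ := n * (levelDegree C J N * torsionExp C N (levelDegree C J N))

omit hN in
/-- `dvd_boostExp` (structure lemma of the genuine `(∗ĝp)` levels). [claim: Mochizuki2012, status: disputed] (IUTchII §1 Ex 1.8 (vii), kurims p.40) -/
theorem dvd_boostExp (n : ℕ+) : (n : ℕ) ∣ (boostExp C J N n : ℕ) :=
  ⟨(levelDegree C J N : ℕ) * torsionExp C N (levelDegree C J N), by unfold boostExp; simp [PNat.mul_coe]⟩

omit hN in
/-- `boostExp_dvd` (structure lemma of the genuine `(∗ĝp)` levels). [claim: Mochizuki2012, status: disputed] (IUTchII §1 Ex 1.8 (vii), kurims p.40) -/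
theorem boostExp_dvd (m n : ℕ+) (h : (m : ℕ) ∣ n) : (boostExp C J N m : ℕ) ∣ boostExp C J N n := by
  unfold boostExp
  simp only [PNat.mul_coe]
  exact mul_dvd_mul_right h _

omit hN in
/-- `coe_boostExp` (structure lemma of the genuine `(∗ĝp)` levels). [claim: Mochizuki2012, status: disputed] (IUTchII §1 Ex 1.8 (vii), kurims p.40) -/
theorem coe_boostExp (n : ℕ+) : (boostExp C J N n : ℕ) =
    (n : ℕ) * (levelDegree C J N : ℕ) * (torsionExp C N (levelDegree C J N) : ℕ) := by
  unfold boostExp; simp [PNat.mul_coe, mul_assoc]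

/-- **The boost lemma** (core of the profinite Hilbert 90): with `d = [J:N]` and `M` the torsion exponent of level `N`
for `d`, an element `f ∈ (k̄^×)^J` which is an `E(n) = n·d·M`-th power in `(k̄^×)^N` is an `n`-th power in `(k̄^×)^J`
(norms: `f^d = N(t)^{ndM}`; the `d`-torsion discrepancy is an `M`-th power of level `N`, hence trivial).
[cite: NeukirchANT1999, Ch. IV §2 p.274] -/
theorem mem_pow_of_inclusion_mem_pow (n : ℕ+) (f : fixedUnits C (J : Subgroup (C.K ≃ₐ[C.k] C.K)))
    (hf : Subgroup.inclusion (fixedUnits_mono C hle) f ∈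
      PowCompletion.powSubgroup (fixedUnits C (N : Subgroup (C.K ≃ₐ[C.k] C.K))) (boostExp C J N n)) :
    f ∈ PowCompletion.powSubgroup (fixedUnits C (J : Subgroup (C.K ≃ₐ[C.k] C.K))) n := by
  obtain ⟨t, ht⟩ := PowCompletion.mem_powSubgroup_iff.mp hf
  rw [coe_boostExp] at ht
  -- notation
  have hd := coe_levelDegree C J N
  -- `s := N(t) ∈ (k̄^×)^J` with `f^d = s^{ndM}`
  have h1 : f ^ (levelDegree C J N : ℕ) =
      levelNorm C J N t ^ ((n : ℕ) * (levelDegree C J N : ℕ) * (torsionExp C N (levelDegree C J N) : ℕ)) := by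
    rw [← map_pow, ht, levelNorm_inclusion C J N hle]
  -- `ζ := f · (s^{nM})⁻¹` is `d`-torsion in `(k̄^×)^J`
  have hζd : (f * (levelNorm C J N t ^ ((n : ℕ) * (torsionExp C N (levelDegree C J N) : ℕ)))⁻¹) ^
      (levelDegree C J N : ℕ) = 1 := by
    rw [mul_pow, inv_pow, ← pow_mul, h1,
      show (n : ℕ) * (levelDegree C J N : ℕ) * (torsionExp C N (levelDegree C J N) : ℕ) =
        (n : ℕ) * (torsionExp C N (levelDegree C J N) : ℕ) * (levelDegree C J N : ℕ) by ring, mul_inv_cancel]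
  -- its image in `(k̄^×)^N` is an `M`-th power: `((t^d · s⁻¹)^n)^M`
  have hζ1 : f * (levelNorm C J N t ^ ((n : ℕ) * (torsionExp C N (levelDegree C J N) : ℕ)))⁻¹ = 1 := by
    apply Subgroup.inclusion_injective (fixedUnits_mono C hle)
    rw [map_one]
    apply torsionExp_spec C N (levelDegree C J N)
    · rw [← map_pow, hζd, map_one]
    · refine ⟨(t ^ (levelDegree C J N : ℕ) * (Subgroup.inclusion (fixedUnits_mono C hle) (levelNorm C J N t))⁻¹) ^ (n : ℕ), ?_⟩
      rw [map_mul, map_inv, map_pow, ← ht, ← pow_mul, mul_pow, inv_pow, ← pow_mul,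
        show (levelDegree C J N : ℕ) * ((n : ℕ) * (torsionExp C N (levelDegree C J N) : ℕ)) =
          (n : ℕ) * (levelDegree C J N : ℕ) * (torsionExp C N (levelDegree C J N) : ℕ) by ring]
  have hfs : f = levelNorm C J N t ^ ((n : ℕ) * (torsionExp C N (levelDegree C J N) : ℕ)) := by
    rwa [mul_inv_eq_one] at hζ1
  refine PowCompletion.mem_powSubgroup_iff.mpr ⟨levelNorm C J N t ^ (torsionExp C N (levelDegree C J N) : ℕ), ?_⟩
  rw [← pow_mul, mul_comm, ← hfs]

/-- **Profinite Hilbert 90, part 1 (normal case)**: the transition map `((k̄^×)^J)^∧ → ((k̄^×)^N)^∧` is INJECTIVE for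
`N ⊴ Gal(k̄/k)` open, `N ⊆ J`. [cite: NeukirchANT1999, Ch. IV §2 p.274] -/
theorem levelMap_injective_of_normal : Function.Injective (levelMap C ⟨J⟩ ⟨N⟩ hle) :=
  PowCompletion.map_injective_of _ fun n =>
    ⟨boostExp C J N n, dvd_boostExp C J N n, fun f hf => mem_pow_of_inclusion_mem_pow C J N hle n f hf⟩

end NormFacts

/-- **The transition maps of `O^ĝp` are injective** (`((k̄^×)^{J})^∧ ↪ ((k̄^×)^{J'})^∧` for `J' ⊆ J` open): refine `J'`
to an open NORMAL `N ⊆ J'` and use the normal case. [cite: NeukirchANT1999, Ch. IV §2 p.274] -/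
theorem levelMap_injective (i j : GhatLevel C) (h : i ≤ j) : Function.Injective (levelMap C i j h) := by
  obtain ⟨N, hNle, hNn⟩ := exists_openNormal_le C j.J
  haveI := hNn
  have hiN : i ≤ (⟨N⟩ : GhatLevel C) := fun σ hσ => h (hNle hσ)
  have hjN : j ≤ (⟨N⟩ : GhatLevel C) := fun σ hσ => hNle hσ
  have hinj : Function.Injective (levelMap C i ⟨N⟩ hiN) := levelMap_injective_of_normal C i.J N hiN
  have hcomp : ⇑(levelMap C i ⟨N⟩ hiN) = ⇑(levelMap C j ⟨N⟩ hjN) ∘ ⇑(levelMap C i j h) := by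
    funext x
    exact (DirectedSystem.map_map (f := fun a b hab => ⇑(levelMap C a b hab)) h hjN x).symm
  rw [hcomp] at hinj
  exact hinj.of_comp

/-- **`ofLevel : ((k̄^×)^J)^∧ → O^ĝp` is injective** for every level. [cite: NeukirchANT1999, Ch. IV §2 p.274] -/
theorem ofLevel_injective (i : GhatLevel C) : Function.Injective (ofLevel C i) :=
  DirectLimit.mk_injective (f := levelMap C) (fun a b hab => levelMap_injective C a b hab) i

/-! ## Profinite Hilbert 90, part 2: the `J`-invariants of `((k̄^×)^N)^∧` come from `((k̄^×)^J)^∧` -/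

section Invariants

variable (J N : OpenSubgroup (C.K ≃ₐ[C.k] C.K)) (hle : (N : Subgroup (C.K ≃ₐ[C.k] C.K)) ≤ J)
  [hN : (N : Subgroup (C.K ≃ₐ[C.k] C.K)).Normal]

/-- ONE STEP of the descent: from the `E(n)·d`-th component of a `J`-invariant `z ∈ ((k̄^×)^N)^∧`, an element
`b ∈ (k̄^×)^J` representing the `E(n)`-th component of `z` (norm trick + torsion exponent).
[cite: NeukirchANT1999, Ch. IV §2 p.274] -/
theorem exists_rep_invariant (z : levelGroup C ⟨N⟩)
    (hz : ∀ σ : C.K ≃ₐ[C.k] C.K, σ ∈ (J : Subgroup (C.K ≃ₐ[C.k] C.K)) → PowCompletion.map (galLevel C N σ) z = z)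
    (n : ℕ+) :
    ∃ b : fixedUnits C (J : Subgroup (C.K ≃ₐ[C.k] C.K)),
      PowCompletion.mapLevel (Subgroup.inclusion (fixedUnits_mono C hle)) (boostExp C J N n) (QuotientGroup.mk b) =
        PowCompletion.component (boostExp C J N n) z := by
  -- a representative `a` of `z` at level `E·d`
  obtain ⟨a, ha⟩ := QuotientGroup.mk_surjective (PowCompletion.component (boostExp C J N n * levelDegree C J N) z)
  -- invariance at level `E·d`: `σ a = a · c_σ^{E d}`
  have hσ : ∀ σ : C.K ≃ₐ[C.k] C.K, σ ∈ (J : Subgroup (C.K ≃ₐ[C.k] C.K)) →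
      ∃ c : fixedUnits C (N : Subgroup (C.K ≃ₐ[C.k] C.K)),
        galLevel C N σ a = a * c ^ ((boostExp C J N n : ℕ) * (levelDegree C J N : ℕ)) := by
    intro σ hσJ
    have h1 := congrArg (PowCompletion.component (boostExp C J N n * levelDegree C J N)) (hz σ hσJ)
    rw [PowCompletion.component_map_mk _ z _ a ha.symm, ← ha, QuotientGroup.eq,
      PowCompletion.mem_powSubgroup_iff] at h1
    obtain ⟨c, hc⟩ := h1
    rw [PNat.mul_coe] at hc
    refine ⟨c⁻¹, ?_⟩
    rw [inv_pow]
    exact eq_mul_inv_of_mul_eq (mul_eq_of_eq_inv_mul hc)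
  obtain ⟨c, hc⟩ := levelNorm_eq_pow_mul_pow C J N a _ hσ
  -- `a' := a · c^E` has `a'^d = N(a)`, a `J`-invariant
  have ha'd : (a * c ^ (boostExp C J N n : ℕ)) ^ (levelDegree C J N : ℕ) =
      Subgroup.inclusion (fixedUnits_mono C hle) (levelNorm C J N a) := by
    apply Subtype.ext
    change (((a * c ^ (boostExp C J N n : ℕ)) ^ (levelDegree C J N : ℕ) : fixedUnits C _) : (C.K)ˣ) =
      ((levelNorm C J N a : fixedUnits C _) : (C.K)ˣ)
    rw [hc, Subgroup.coe_pow, Subgroup.coe_mul, Subgroup.coe_pow, mul_pow, ← pow_mul, mul_comm (boostExp C J N n : ℕ)]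
  -- `a'` is `J`-invariant: `σ a' / a'` is `d`-torsion and an `M`-th power of level `N`
  have ha'J : ∀ σ : C.K ≃ₐ[C.k] C.K, σ ∈ (J : Subgroup (C.K ≃ₐ[C.k] C.K)) →
      galLevel C N σ (a * c ^ (boostExp C J N n : ℕ)) = a * c ^ (boostExp C J N n : ℕ) := by
    intro σ hσJ
    obtain ⟨cσ, hcσ⟩ := hσ σ hσJ
    have key : galLevel C N σ (a * c ^ (boostExp C J N n : ℕ)) / (a * c ^ (boostExp C J N n : ℕ)) = 1 := by
      apply torsionExp_spec C N (levelDegree C J N)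
      · rw [div_pow, ← map_pow, ha'd, galLevel_inclusion C J N hle σ hσJ, div_self']
      · refine ⟨(cσ ^ (levelDegree C J N : ℕ) * (galLevel C N σ c / c)) ^ ((n : ℕ) * (levelDegree C J N : ℕ)), ?_⟩
        conv_rhs =>
          rw [map_mul, map_pow, hcσ, mul_assoc, mul_div_mul_left_eq_div, mul_div_assoc, ← div_pow,
            mul_comm (boostExp C J N n : ℕ) (levelDegree C J N : ℕ), pow_mul, ← mul_pow, coe_boostExp, pow_mul]
    rwa [div_eq_one] at key
  have ha'mem : (((a * c ^ (boostExp C J N n : ℕ) : fixedUnits C _)) : (C.K)ˣ) ∈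
      fixedUnits C (J : Subgroup (C.K ≃ₐ[C.k] C.K)) := fun σ hσJ =>
    congrArg (fun w : fixedUnits C (N : Subgroup (C.K ≃ₐ[C.k] C.K)) => ((w : (C.K)ˣ) : C.K)) (ha'J σ hσJ)
  refine ⟨⟨_, ha'mem⟩, ?_⟩
  -- the `E`-th component of `z` is the class of `a` (projection from level `E d`), and `a' ≡ a mod E-th powers`
  rw [PowCompletion.mapLevel_mk,
    ← PowCompletion.component_compat z (boostExp C J N n) (boostExp C J N n * levelDegree C J N) (dvd_mul_right _ _),
    ← ha, PowCompletion.proj_mk, QuotientGroup.eq, PowCompletion.mem_powSubgroup_iff]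
  refine ⟨c⁻¹, ?_⟩
  have hincl : Subgroup.inclusion (fixedUnits_mono C hle) ⟨_, ha'mem⟩ = a * c ^ (boostExp C J N n : ℕ) := Subtype.ext rfl
  rw [hincl, mul_inv_rev, inv_mul_cancel_right, inv_pow]

/-- The chosen representatives `b_n ∈ (k̄^×)^J` of the descent. [cite: NeukirchANT1999, Ch. IV §2 p.274] -/
def invariantRep (z : levelGroup C ⟨N⟩)
    (hz : ∀ σ : C.K ≃ₐ[C.k] C.K, σ ∈ (J : Subgroup (C.K ≃ₐ[C.k] C.K)) → PowCompletion.map (galLevel C N σ) z = z)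
    (n : ℕ+) : fixedUnits C (J : Subgroup (C.K ≃ₐ[C.k] C.K)) :=
  (exists_rep_invariant C J N hle z hz n).choose

/-- `invariantRep_spec` (structure lemma of the genuine `(∗ĝp)` levels). [claim: Mochizuki2012, status: disputed] (IUTchII §1 Ex 1.8 (vii), kurims p.40) -/
theorem invariantRep_spec (z : levelGroup C ⟨N⟩)
    (hz : ∀ σ : C.K ≃ₐ[C.k] C.K, σ ∈ (J : Subgroup (C.K ≃ₐ[C.k] C.K)) → PowCompletion.map (galLevel C N σ) z = z)
    (n : ℕ+) :
    PowCompletion.mapLevel (Subgroup.inclusion (fixedUnits_mono C hle)) (boostExp C J N n)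
        (QuotientGroup.mk (invariantRep C J N hle z hz n)) = PowCompletion.component (boostExp C J N n) z :=
  (exists_rep_invariant C J N hle z hz n).choose_spec

/-- Two `J`-invariant units representing components of `z` at boosted levels `E(m) ∣ E'` agree modulo `m`-th powers
of `(k̄^×)^J` (the boost lemma). [cite: NeukirchANT1999, Ch. IV §2 p.274] -/
theorem rep_compat (z : levelGroup C ⟨N⟩) (m : ℕ+) {E' : ℕ+} (hE : (boostExp C J N m : ℕ) ∣ E')
    (b b' : fixedUnits C (J : Subgroup (C.K ≃ₐ[C.k] C.K)))
    (hb : PowCompletion.mapLevel (Subgroup.inclusion (fixedUnits_mono C hle)) (boostExp C J N m) (QuotientGroup.mk b) =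
      PowCompletion.component (boostExp C J N m) z)
    (hb' : PowCompletion.mapLevel (Subgroup.inclusion (fixedUnits_mono C hle)) E' (QuotientGroup.mk b') =
      PowCompletion.component E' z) :
    (QuotientGroup.mk b' : fixedUnits C (J : Subgroup (C.K ≃ₐ[C.k] C.K)) ⧸ PowCompletion.powSubgroup _ m) =
      QuotientGroup.mk b := by
  rw [QuotientGroup.eq]
  apply mem_pow_of_inclusion_mem_pow C J N hle m
  -- `incl b' ≡ z ≡ incl b` modulo `E(m)`-th powers of level `N`
  have h1 : PowCompletion.mapLevel (Subgroup.inclusion (fixedUnits_mono C hle)) (boostExp C J N m) (QuotientGroup.mk b') =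
      PowCompletion.component (boostExp C J N m) z := by
    rw [← PowCompletion.component_compat z _ E' hE, ← hb', PowCompletion.proj_mapLevel, PowCompletion.proj_mk]
  rw [← hb, PowCompletion.mapLevel_mk, PowCompletion.mapLevel_mk, QuotientGroup.eq] at h1
  rwa [map_mul, map_inv]

/-- **Profinite Hilbert 90, part 2**: a `J`-INVARIANT element of `((k̄^×)^N)^∧` (`N ⊴ Gal(k̄/k)` open, `N ⊆ J`, `J` acting
through `J/N = Gal(k̄^N/k̄^J)`) comes from `((k̄^×)^J)^∧` — elementary proof by norms and torus Kummer-faithfulness, no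
cohomology. [cite: NeukirchANT1999, Ch. IV §2 p.274] -/
theorem exists_levelMap_eq_of_invariant (z : levelGroup C ⟨N⟩)
    (hz : ∀ σ : C.K ≃ₐ[C.k] C.K, σ ∈ (J : Subgroup (C.K ≃ₐ[C.k] C.K)) → PowCompletion.map (galLevel C N σ) z = z) :
    ∃ y : levelGroup C ⟨J⟩, levelMap C ⟨J⟩ ⟨N⟩ hle y = z := by
  let b := invariantRep C J N hle z hz
  have hb := invariantRep_spec C J N hle z hz
  refine ⟨PowCompletion.mk (fun n => QuotientGroup.mk (b n)) fun m n hmn => ?_, ?_⟩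
  · rw [PowCompletion.proj_mk]
    exact rep_compat C J N hle z m (boostExp_dvd C J N m n hmn) (b m) (b n) (hb m) (hb n)
  · ext m
    change PowCompletion.component m (PowCompletion.map _ _) = _
    rw [PowCompletion.component_map, PowCompletion.component_mk,
      ← PowCompletion.component_compat z m (boostExp C J N m) (dvd_boostExp C J N m), ← hb m,
      PowCompletion.proj_mapLevel, PowCompletion.proj_mk]

end Invariants

/-! ## The torsion of `O^ĝp` is `η(μ(k̄))` -/

/-- **Torsion of `O^ĝp(G)`**: an `n`-torsion element of `O^ĝp = lim→_J ((k̄^×)^J)^∧` is `η(ζ)` for an `n`-th root of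
unity `ζ ∈ k̄` (levels are torus Kummer-faithful and `|μ_n| ≤ n`). [cite: NeukirchANT1999, Ch. IV §2 p.274] -/
theorem exists_eq_toOghat_of_pow_eq_one {n : ℕ+} (w : Oghat C) (hw : w ^ (n : ℕ) = 1) :
    ∃ ζ : (C.K)ˣ, ζ ^ (n : ℕ) = 1 ∧ w = toOghat C ζ := by
  induction w using DirectLimit.induction with
  | ih i x =>
    have hx : x ^ (n : ℕ) = 1 := by
      apply ofLevel_injective C i
      rw [map_pow, map_one]
      exact hw
    obtain ⟨ζ, hζ, hxζ⟩ := PowCompletion.exists_eq_of_of_pow_eq_one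
      (finite_level_torsion C (i.J : Subgroup (C.K ≃ₐ[C.k] C.K)) n) x hx
    refine ⟨(ζ : (C.K)ˣ), by rw [← Subgroup.coe_pow, hζ, Subgroup.coe_one], ?_⟩
    change ofLevel C i x = _
    rw [hxζ, toOghat_eq_ofLevel C (ζ : (C.K)ˣ) i ζ.2]

end AbsTopMonoids.Genuine

end Literature.IUT.HodgeArakelov

end
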